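import Mathlib
import Summits.ResolutionOfSingularities.ResolutionOfSingularities.Theorems.WeightedInvariantLocalWeightedDropWildMonicSCleanStepExists
import Summits.ResolutionOfSingularities.ResolutionOfSingularities.Theorems.WeightedInvariantLocalWeightedDropWildMonicWCleanProcess

/-!
# `WeightedInvariant.LocalWeightedDrop`, line `hasse-ridge-face-selection`, S3ρ sub-stub S3ρD `stub_wildMonicSurfaceDescent`:
# THE CLEANING GERM WITH ITS SUPPORT CLAUSE — the engine of Perlega Lemma 5.1.8 (and 5.2.6) for monic tuples

Crux item stmt-ResolutionOfSingularities-8899 `LocalWeightedDrop` (route `ResolutionOfSingularities/WeightedInvariant`), engine of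
the door `HypersurfaceCentreConstruction` stmt-ResolutionOfSingularities-19897.  [OURS · L1 W4.3, chain w43, res-L1-w43-stub-7 (second
seat on S3ρ under res-type-083); pipeline step «W-clean / W-re-clean» of Uk-ρD1 (STATUS 2026-08-27 09:2xZ).  MODEL: S. Perlega,
thesis Wien 2017 / arXiv:2011.14443, Ch. 5 §1.2 (the `w`-cleaning process, Prop. 5.1.5), Lemma 5.1.8 (w_cleaning_preserves_v_cleaning:
«a `ν`-cleaning step preserves `w`-cleanness» — because the germ `g = −C(c,q)^{-1}G`, `G^q = in_ν(f_{c−q})`, satisfies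
`w(g) ≥ (1/q)·w(f_{c−q})` for EVERY `w`), and Ch. 9 p0105: «we may assume `f` clean with respect to finitely many weighted order
functions».  Nothing here is a statement of H. Hironaka's manuscript [claim: Hironaka2017, status: under-review]; OUR objects.]

* `exists_cleaning_germ_supp` — the cleaning germ of `…WildMonicWCleanStep` (p504931) WITH ITS SUPPORT CLAUSE: every monomial `x^α` of
  `g` has `x^{q·α}` in the support of `A_{d−q}` (Frobenius: `coeff_{qα}(G^q) = coeff_α(G)^q`);
* `le_factorial_mul_weightedOrder_of_supp` — hence `d!·ord_w(g) ≥` any lower bound of the scaled `w`-weights of `A_{d−q}`, for EVERY `w`: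
  condition (a) of Lemma 5.1.7 (`slotWOrd w A (d−q) ≤ d!·ord_w g`) and the `s`-line bound `Θ ≤ d!·ord_{w_s} g`;
-/

set_option linter.dupNamespace false -- mandated namespace of this single-conjunct summit

noncomputable section

namespace Summit.ResolutionOfSingularities.ResolutionOfSingularities.Theorems

namespace WildMonic

open MvPowerSeries MonicDescent

variable {k : Type} [Field k] (p : ℕ) [Fact p.Prime] [CharP k p] (w : Fin 2 → ℕ) {d : ℕ}
  (A : Fin d → MvPowerSeries (Fin 2) k)

/-! ## The germ with its support clause -/

section Germ

variable [PerfectRing k p]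

/-- THE CLEANING GERM WITH ITS SUPPORT CLAUSE: as `exists_cleaning_germ` (p504931), and every monomial `x^α` of `g` has `x^{q·α}` in the
support of `A_{d−q}` (indeed in its `w`-initial part). -/
theorem exists_cleaning_germ_supp (hd : 0 < d) (hm : wMin w A ≠ ⊤) (hA0 : constantCoeff (A (qSlot p d hd)) = 0)
    (h : ¬ IsWClean p w A) :
    ∃ g : MvPowerSeries (Fin 2) k, constantCoeff g = 0 ∧ (d.factorial : ℕ∞) * g.weightedOrder w = wMin w A ∧
      (A (qSlot p d hd)).weightedOrder w <
        (A (qSlot p d hd) + ((d.choose (qSlot p d hd : ℕ) : ℕ) : MvPowerSeries (Fin 2) k) * g ^ qOf p d).weightedOrder w ∧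
      ∀ α : Fin 2 →₀ ℕ, coeff α g ≠ 0 → coeff (qOf p d • α) (A (qSlot p d hd)) ≠ 0 := by
  haveI : ExpChar k p := ExpChar.prime (Fact.out : p.Prime)
  set i₀ := qSlot p d hd with hi₀
  set F := A i₀ with hF
  have hq : qOf p d ≤ d := Nat.le_of_dvd hd (qOf_dvd p d)
  have hdi : d - (i₀ : ℕ) = qOf p d := by rw [hi₀, qSlot_val]; omega
  have hsi : slotWOrd w A i₀ = wMin w A := slot_eq_of_not_isWClean p w A hd h
  have hFfin : F.weightedOrder w ≠ ⊤ := weightedOrder_ne_top_of_slotWOrd_ne_top w A (by rw [hsi]; exact hm)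
  have hFne : F ≠ 0 := by rwa [Ne, ← weightedOrder_eq_top_iff (w := w)]
  set n₀ := (F.weightedOrder w).toNat with hn₀
  have hn₀' : (n₀ : ℕ∞) = F.weightedOrder w := ENat.coe_toNat hFfin
  set H := weightedHomogeneousComponent w n₀ F with hH
  have hHsupp : Literature.RingTheory.MvPowerSeries.IsSupportedOnMultiples (p ^ d.factorization p) H := by
    intro e ⟨i, hi⟩
    by_contra hne
    have he := (coeff_initPart_ne_zero_iff w hFne e).mp hne
    have hdv := dvd_of_not_isWClean p w A hd h he
    fin_cases i
    · exact hi hdv.1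
    · exact hi hdv.2
  obtain ⟨G, hG⟩ := Literature.RingTheory.MvPowerSeries.exists_pow_eq_of_isSupportedOnMultiples p hHsupp
  change G ^ qOf p d = H at hG
  have hC : ((d.choose (i₀ : ℕ) : ℕ) : k) ≠ 0 := by
    rw [← Nat.choose_symm (qSlot p d hd).2.le, hdi]; exact natCast_choose_qOf_ne_zero (k := k) p hd
  obtain ⟨c, hc⟩ : ∃ c : k, c ^ qOf p d = -((d.choose (i₀ : ℕ) : ℕ) : k)⁻¹ := by
    refine ⟨(iterateFrobeniusEquiv k p (d.factorization p)).symm (-((d.choose (i₀ : ℕ) : ℕ) : k)⁻¹), ?_⟩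
    rw [show qOf p d = p ^ d.factorization p from rfl, ← iterateFrobenius_def]
    exact (iterateFrobeniusEquiv k p (d.factorization p)).apply_symm_apply _
  have hc0 : c ≠ 0 := by
    intro h0; rw [h0, zero_pow (qOf_pos p d).ne'] at hc
    exact (neg_ne_zero.mpr (inv_ne_zero hC)) hc.symm
  refine ⟨C c * G, ?_, ?_, ?_, ?_⟩
  · have hG0 : constantCoeff G ^ qOf p d = 0 := by
      rw [← map_pow, hG, hH, ← coeff_zero_eq_constantCoeff, coeff_weightedHomogeneousComponent]
      split_ifs
      · rw [coeff_zero_eq_constantCoeff]; exact hA0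
      · rfl
    rw [map_mul, constantCoeff_C, pow_eq_zero_iff (qOf_pos p d).ne' |>.mp hG0, mul_zero]
  · have hHord : H.weightedOrder w = n₀ := by
      apply le_antisymm
      · obtain ⟨e, he, hwe⟩ := exists_coeff_ne_zero_and_weightedOrder w (f := F) (by rw [hn₀'.symm, ENat.toNat_coe])
        have heH : coeff e H ≠ 0 := by
          rw [hH, coeff_weightedHomogeneousComponent, if_pos (by exact_mod_cast hwe.trans hn₀'.symm)]; exact he
        exact le_trans (weightedOrder_le w heH) (by exact_mod_cast (hwe.trans hn₀'.symm).le)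
      · refine le_weightedOrder w fun e hwe => ?_
        rw [hH, coeff_weightedHomogeneousComponent, if_neg]
        exact fun heq => (lt_irrefl _) (by rw [heq] at hwe; exact_mod_cast hwe)
    have hGord : (qOf p d : ℕ∞) * G.weightedOrder w = n₀ := by
      rw [← hHord, ← hG, weightedOrder_pow_eq]
    rw [weightedOrder_C_mul_of_ne_zero w hc0]
    have hfac : (d.factorial : ℕ∞) = (slotWeight d i₀ : ℕ∞) * (qOf p d : ℕ∞) := by
      rw [← Nat.cast_mul, ← hdi, mul_comm, sub_mul_slotWeight]
    rw [hfac, mul_assoc, hGord, hn₀', ← hsi]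
    rfl
  · have hCg : ((d.choose (i₀ : ℕ) : ℕ) : MvPowerSeries (Fin 2) k) * (C c * G) ^ qOf p d = -H := by
      rw [mul_pow, ← map_pow, hc, hG, ← map_natCast (C : k →+* MvPowerSeries (Fin 2) k), ← mul_assoc, ← map_mul,
        mul_neg, mul_inv_cancel₀ hC, map_neg, map_one, neg_one_mul]
    rw [hCg, ← hn₀']
    refine lt_of_le_of_ne (le_weightedOrder w fun e hwe => ?_) fun heq => ?_
    · rw [map_add, map_neg, coeff_eq_zero_of_lt_weightedOrder w (by rw [← hn₀']; exact hwe), hH,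
        coeff_weightedHomogeneousComponent, if_neg (by intro h; rw [h] at hwe; exact lt_irrefl _ (by exact_mod_cast hwe)),
        neg_zero, add_zero]
    · obtain ⟨e, he, hwe⟩ := exists_coeff_ne_zero_and_weightedOrder w (f := F + -H) (by rw [← heq, ENat.toNat_coe])
      rw [← heq, Nat.cast_inj] at hwe
      apply he
      rw [map_add, map_neg, hH, coeff_weightedHomogeneousComponent, if_pos hwe, add_neg_cancel]
  · -- THE SUPPORT CLAUSE: `coeff_{qα}(G^q) = (coeff_α G)^q`
    intro α hα
    rw [coeff_C_mul] at hα
    have hGα : coeff α G ≠ 0 := fun h0 => hα (by rw [h0, mul_zero])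
    have hHα : coeff (qOf p d • α) H ≠ 0 := by
      rw [← hG, show qOf p d = p ^ d.factorization p from rfl, Literature.RingTheory.MvPowerSeries.coeff_smul_pow_pow]
      exact pow_ne_zero _ hGα
    exact ((coeff_initPart_ne_zero_iff w hFne _).mp hHα).1

end Germ

/-! ## Consequences of the support clause -/

omit [Fact p.Prime] [CharP k p] in
/-- If every monomial `x^α` of `g` has `x^{q·α}` in the support of `A_{d−q}`, then `d!·ord_{w′}(g)` is at least any lower bound of the scaled
`w′`-weights of the support of `A_{d−q}` — for EVERY weight `w′`. -/
theorem le_factorial_mul_weightedOrder_of_supp (hd : 0 < d) {g : MvPowerSeries (Fin 2) k}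
    (hsupp : ∀ α : Fin 2 →₀ ℕ, coeff α g ≠ 0 → coeff (qOf p d • α) (A (qSlot p d hd)) ≠ 0) (w' : Fin 2 → ℕ) {x : ℕ∞}
    (hx : ∀ e : Fin 2 →₀ ℕ, coeff e (A (qSlot p d hd)) ≠ 0 → x ≤ ((slotWeight d (qSlot p d hd) * Finsupp.weight w' e : ℕ) : ℕ∞)) :
    x ≤ (d.factorial : ℕ∞) * g.weightedOrder w' := by
  by_cases hg : g = 0
  · rw [hg, weightedOrder_zero, ENat.mul_top (by exact_mod_cast (Nat.factorial_pos d).ne')]; exact le_top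
  obtain ⟨α, hα, hwα⟩ := exists_coeff_ne_zero_and_weightedOrder w' (f := g) (ENat.coe_toNat (by rwa [Ne, weightedOrder_eq_top_iff]))
  rw [← hwα]
  have h := hx _ (hsupp α hα)
  rw [slotWeight_mul_weight_qOf_smul w' α p (qSlot p d hd) (qSlot_val p hd)] at h
  exact_mod_cast h

omit [Fact p.Prime] [CharP k p] in
/-- In particular CONDITION (a) OF LEMMA 5.1.7 holds for every weight: `slotWOrd w′ A (d−q) ≤ d!·ord_{w′}(g)`. -/
theorem slotWOrd_le_of_supp (hd : 0 < d) {g : MvPowerSeries (Fin 2) k}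
    (hsupp : ∀ α : Fin 2 →₀ ℕ, coeff α g ≠ 0 → coeff (qOf p d • α) (A (qSlot p d hd)) ≠ 0) (w' : Fin 2 → ℕ) :
    slotWOrd w' A (qSlot p d hd) ≤ (d.factorial : ℕ∞) * g.weightedOrder w' :=
  le_factorial_mul_weightedOrder_of_supp p A hd hsupp w' ((le_slotWOrd_iff A w' _).1 le_rfl)

omit [Fact p.Prime] [CharP k p] in
/-- … and the germ lies on or above the `s`-line: `Θ = s·δ + w_s(r) ≤ d!·ord_{w_s}(g)`. -/
theorem theta_le_of_supp (hd : 0 < d) {g : MvPowerSeries (Fin 2) k}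
    (hsupp : ∀ α : Fin 2 →₀ ℕ, coeff α g ≠ 0 → coeff (qOf p d • α) (A (qSlot p d hd)) ≠ 0) (E : Finset (Fin 2)) {s : ℕ}
    (hs : (s : ℕ∞) ≤ sFlag E (newtonSet A)) :
    ((s * dRes E (newtonSet A) + Finsupp.weight ![(dRes E (newtonSet A)).factorial, s] (excExp E (newtonSet A)) : ℕ) : ℕ∞) ≤
      (d.factorial : ℕ∞) * g.weightedOrder ![(dRes E (newtonSet A)).factorial, s] :=
  le_factorial_mul_weightedOrder_of_supp p A hd hsupp _ fun e he => by exact_mod_cast theta_le_val E A rfl rfl hs _ he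

end WildMonic

end Summit.ResolutionOfSingularities.ResolutionOfSingularities.Theorems

end
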